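import Summits.HodgeConjecture.HodgeConjecture.Cruxes.H413.Lines.F0_P3c_S2SharpPaydown            -- LH1 leaf: R1 S2♯ head `stub_S2sharp_of_organs`, R2 FIN `S2FinLetter`∕`stub_S2fin` :348, R3 Ξ∞ `S2QpsiLetter`∕`stub_S2qpsi` :363, ★ `s2CentralIota_holds`
import Summits.HodgeConjecture.HodgeConjecture.Cruxes.H413.Lines.F0_P3c_PKtuplePaydown             -- LH7 leaf: R4 PK head `PKtupleK2_of_organs` :830, organs O1″ `stub_PKtupleBaseK2μ` :653 ∕ O2 `stub_PKrigidCore` :657 (sorried), O3∕O4∕O5∕O8a∕O8b ★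
import Summits.HodgeConjecture.HodgeConjecture.Cruxes.H413.Lines.F0_P3c_DbTPaydown                 -- LH10 leaf: R5 O2♮ `StubXiPacketRigidCoreSc` :342 ∕ `stub_xiPacketRigidCoreSc` :423, ★ projections :427∕:435
import Summits.HodgeConjecture.HodgeConjecture.Cruxes.H413.Lines.K2_E1_TraceFormulaBeta            -- E1 tier-0: R6 input socket `stub_E1_St1383 : E1St1383Letter` :105 + ★ `stSpectralHyp_of_line` :152 → (S-β)
-- R90 SECTION FILES IN THE TREE (ED. 2 of this index = every R90 file written by 2026-09-04T15:41Z; each import below is a junction act: the files co-elaborate)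
import Summits.HodgeConjecture.HodgeConjecture.Cruxes.H413.Lines.R90_S1_NonsplitLocalPacketsA       -- S1 A (cc03b5c0bd9b3393, BUILT BW159): sockets `stub_R90_122_sphericalConstituent_unique` (TOP A1), `_keys_trichotomy`, `_bz_twoConstituents`, `_case1_constituents`; heads `unramLaw_xi_nonsplit_of_stubs`, `cardLaw_xi_nonsplit`
import Summits.HodgeConjecture.HodgeConjecture.Cruxes.H413.Lines.R90_S1_SplitLocalPacketsB          -- S1 B (2667ad3b83446aa4, BUILT BW158): socket `stub_S1_split_parabolicInd_irreducible_of_unitary : SocketSplitInducedIrreducible`; heads `xiAPacket_split_*`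
import Summits.HodgeConjecture.HodgeConjecture.Cruxes.H413.Lines.R90_S2_ArchPacketXiA              -- S2 ΞA (61ebad0344dd437e, BUILT BW149): sockets Σ∞-ι `stub_R90_S2_archPacketIota`, Σ∞-cpt `stub_R90_S2_archPacketCompact`; PAID `s2Qpsi_paid : S2QpsiLetter` (R3)
import Summits.HodgeConjecture.HodgeConjecture.Cruxes.H413.Lines.R90_S3_EndoFibreDefsC             -- S3 C (27665ab9dc1048f5; LEAD #10 (A) ONE HOME of the fibre objects): defs `IsStableFinsetH`, `IsEndoExpansion`, `endoCoeff`, `endoFibre` + read-backs, 0 socket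
import Summits.HodgeConjecture.HodgeConjecture.Cruxes.H413.Lines.R90_S3_EndoCharIdentityA          -- S3 A (fd59f5a76fae402d; imports S3 C + S4 B = edges [def] S3-C → S3-A, S4-B → S3-A): socket `stub_R90_S3_endoExpansion_exists` (13.1.1 endoscopic expansion at Δ‴)
import Summits.HodgeConjecture.HodgeConjecture.Cruxes.H413.Lines.R90_S4_HPacketsU2B                -- S4 B ED. 2 (bf1d467e647304d8): #B1 `stub_R90_S4_H_admissible` ★-TIED (p861515); sockets #B2–#B6 (`_disjoint`, `_cover`, `_card`, `_lds`, `_stable`)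
import Summits.HodgeConjecture.HodgeConjecture.Cruxes.H413.Lines.R90_S5_BaseChangeSpineA           -- S5 A ED. 2 (5245fcfbb9e0): (G∞) `stub_R90_1336c_membership : XiMembershipOfArchJLetter` (13.3.6 (c) + 14.6.4 spine socket)
import Summits.HodgeConjecture.HodgeConjecture.Cruxes.H413.Lines.R90_S5_GlobalPacketFinB           -- S5 B ED. 2 (ef90279e5d46534a, BUILT BW147∕153): PROVED `s2Fin_of_spine`, `stub_S2fin_of_spine : S2FinLetter` (R2), `s2sharp_of_spine_qpsi`
import Summits.HodgeConjecture.HodgeConjecture.Cruxes.H413.Lines.R90_S5_QuasiSplitRigidityD        -- S5 D ED. 2 (b4c3099060b79e3d): (QS-R) `stub_R90_1335_qsXiRigidity` (S5#4, J3ᴮ producer) + NEW `stub_R90_1336c_qsFinMembership : SocketQsFiniteTriggerMembership`; ★ (QS-R) ⟺ (QS-U), `qsFinMembership_of_memXiFamily`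
import Summits.HodgeConjecture.HodgeConjecture.Cruxes.H413.Lines.R90_S6_StableTFGeomA              -- S6 A ED. 2 (78d94b8f401256d7): texts T1c∕T1d + `mTermCancellationSm_of_spectralB`, `thm1451bSm_of_dichotomy(_S6)`
import Summits.HodgeConjecture.HodgeConjecture.Cruxes.H413.Lines.R90_S6_StableTFSpectralB          -- S6 B (866dde8d92c2553e, BUILT BW162): TOP socket `sock_S6_langlandsDichotomy : LanglandsDichotomy`; engine `mTermCancellationSm_of_dichotomy(_S6)`
import Summits.HodgeConjecture.HodgeConjecture.Cruxes.H413.Lines.R90_S7_PKtupleBaseChainA          -- S7 A ED. 3 (7a5c869120c6e05a): S7#6 `stub_R90_S7_formSignOffRam` ★-TIED := ★ p861477 `R90.S7.formSignOffRam` (FIRST SOCKET PAID IN LINES)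
import Summits.HodgeConjecture.HodgeConjecture.Cruxes.H413.Lines.R90_S8_ContSpecIndexA             -- S8 A (β′) (c5541e9dae5bb0ee): `Pinning`, PROVED `eq1361G_of_pinning`, (e2) `nHalf_of_specs`, FLOOR `sock_S8_ext_kysCentreU2`
import Summits.HodgeConjecture.HodgeConjecture.Cruxes.H413.Lines.R90_S9_InnerFormXiRigiditySockets  -- S9 A ED. 3 (9068bdf0e31814e1): (S-G) `stub_globalXiMembership` B-PAID (0 sorry in A), J3ᴬ `scUnique_of_xiPacketRigidCoreSc`, `xiPacketRigidCoreSc_paid`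
import Summits.HodgeConjecture.HodgeConjecture.Cruxes.H413.Lines.R90_S9_InnerFormTransportB         -- S9 B ED. 2 (e58eb06eba1851d4): B1 `sock_S9_qsXiMembership := S5#4` (J3ᴮ), B2 ★, sockets B3 `sock_S9_similitudeTransport`, B4 `sock_S9_definiteXiMembership`
import Summits.HodgeConjecture.HodgeConjecture.Cruxes.H413.Lines.R90_S10_ZeroSliceDefsC            -- S10 C (87b5f0e69ee1aff4): defs `StabilisedAtEvpHyp`, `classTraceAt`, `weightedCutSum` + PROVED `pinnedEq1383_of_stabilisedAtEvp` (zero-slice road to `Pinned1383Letter`), 0 socket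
import Summits.HodgeConjecture.HodgeConjecture.Cruxes.H413.Lines.R90_S2_ArchPacketsB               -- S2 B (bd6cc7add7519326): §12.3 datum `datum_Ch12Sec3` + laws, socket `stub_R90_S2_piN_ne_piS` (ED. 3 import)
import Summits.HodgeConjecture.HodgeConjecture.Cruxes.H413.Lines.R90_S3_CharIdTransportB            -- S3 B (4755463f29df0141, BUILT BW167): ★ transport lemmas, HEAD `kt2Clause_of_endoExpansion` (14.6.3∕KT2 v-clause) (ED. 3 import)
import Summits.HodgeConjecture.HodgeConjecture.Cruxes.H413.Lines.R90_S4_LocalKitExportA            -- S4 A ED. 1.1 (b5fbaaeb3ca45137, e98cc3e0f41e): E-S4 `rogawskiLocalKit` DEFINED + laws, TOP `stub_R90_S4_localClassification` (ED. 3 import)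
import Summits.HodgeConjecture.HodgeConjecture.Cruxes.H413.Lines.R90_S8_ResidualSpectrumU3B         -- S8 B ED. 1b (bbdabe1a17610433): §13.9 sockets `sock_S8_res_charLine_le`, `_res_classification`, `_resH_classification`, `_resH_charLine_le`, `_res_cuspidal_of_not_piN`, `isPiN_of_equiv` (ED. 3 import)
import Summits.HodgeConjecture.HodgeConjecture.Cruxes.H413.Lines.R90_S2_ArchKitExportA             -- S2 A′ (117cab8c80abc0fa): E-S2 G-side arch kit export (LEAD #10 (B) (a′)), 2 sockets (ED. 4 import)
import Summits.HodgeConjecture.HodgeConjecture.Cruxes.H413.Lines.R90_S3_EndoExpansionByTypeD        -- S3 D (2b313b22276a82ab): endoscopic expansion by type — T-heads, 5 sockets (ED. 4 import)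
import Summits.HodgeConjecture.HodgeConjecture.Cruxes.H413.Lines.R90_S5_HSideExportC               -- S5 C (99ca22a373c71298): E-S5 DEFINED `PacketGOfRecord`∕`PacketHOfRecord`∕`nHOfRecord`∕`discHOfRecord` (𝔊 of record, LEAD #22 J-D2-2) + `stub_R90_S5_discH_nonexceptional` (ED. 4 import)
import Summits.HodgeConjecture.HodgeConjecture.Cruxes.H413.Lines.R90_S6_StableTFReductionC         -- S6 C (34ad5b3656ef872f): stable-TF reduction heads over A∕B, 0 socket (ED. 4 import)
import Summits.HodgeConjecture.HodgeConjecture.Cruxes.H413.Lines.R90_S7_PKtupleSignsB              -- S7 B (cfcc0f0e405e706f): «SIGNS OF RECORD» (BOX PASS), 0 socket (ED. 4 import)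
import Summits.HodgeConjecture.HodgeConjecture.Cruxes.H413.Lines.R90_S10_TFDecompositionD          -- S10 D (806e42d45b021177): TF decomposition heads (J-D2-2∕-3∕-4 per LEAD #22), 0 socket; payer-of-record file for the J-S5→S10 datum (LEAD #16 (A3)) (ED. 4 import)
import Summits.HodgeConjecture.HodgeConjecture.Cruxes.H413.Lines.R90_S2_ArchPacketsTopC             -- S2 C ED. 2 (TOP of B → A′ → C): §12.3 read-backs over the tree datum, the ONE G-side socket σ9 «Prop. 12.3.3 (b) for the kit's A-pair», datum certificate (ED. 4 import)
import Summits.HodgeConjecture.HodgeConjecture.Cruxes.H413.Lines.R90_S3_PrintInputsE                -- S3 E: the PRINTED INPUTS of the S3 hands as named sockets (Props. 13.1.3–13.1.4; ruling S3-R4 «residues are print sockets in FILE E») (ED. 4 import)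
import Summits.HodgeConjecture.HodgeConjecture.Cruxes.H413.Lines.R90_S4_LocalBaseChangeC            -- S4 C: LOCAL BASE CHANGE U(3) → GL₃(E) sockets (Thm. 13.2.1 step one, Prop. 13.2.2 (a), (b₂)) (ED. 4 import)
import Summits.HodgeConjecture.HodgeConjecture.Cruxes.H413.Lines.R90_S5_FloorE2E                    -- S5 E ED. 1: FLOOR (E2) bottom file — GL-side spectral theorems for Res GL_n, n ≤ 3, as NAMED HYPOTHESIS TEXTS (ruling E2-HOST) (ED. 4 import)
import Summits.HodgeConjecture.HodgeConjecture.Cruxes.H413.Lines.R90_S5_GOfRecordC2                 -- S5 C2 ED. 1: THE 𝔊 OF RECORD (`GlobalPacketData` term) (ED. 4 import)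
import Summits.HodgeConjecture.HodgeConjecture.Cruxes.H413.Lines.R90_S6_FloorE1D                    -- S6 D ED. 1: FLOOR (E1) bottom file — smooth transfer + fundamental lemma for U(3) and its endoscopic groups as NAMED HYPOTHESIS TEXTS (ED. 4 import)
import Summits.HodgeConjecture.HodgeConjecture.Cruxes.H413.Lines.R90_S7_RigidCoreJunctionC          -- S7 C ED. 1 (SOCKET): `stub_R90_S7_qsRigidCore : ∀ L, QsRigidCore L` — rigid-core junction (ED. 4 import)
import Summits.HodgeConjecture.HodgeConjecture.Cruxes.H413.Lines.R90_S10_ArchPseudoCoeffExtE        -- S10 E: ARCHIMEDEAN PSEUDO-COEFFICIENT ∕ SIGN-KIT FLOOR — the two NAMED STUBS (§13.8 Props. 13.8.1–13.8.3) (ED. 4 import)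
import Summits.HodgeConjecture.HodgeConjecture.Cruxes.H413.Lines.R90_S10_StabilisedEvpLayerB        -- S10 B: the ONE analytic socket `sock_S10_stabilisedAtEvp` of (13.8.3) + the proved zero-slice head (L9 ★ → C → C2 → B → A) (ED. 4 import)
import Summits.HodgeConjecture.HodgeConjecture.Cruxes.H413.Lines.R90_S3_EndoCharIdentityH3F         -- S3 F ED. 1 (BUILT K18 genuine 22:16Z): the TWO-PLACE EDITION (`h3`) of the TF-dependent S3 sockets (§13.1 pp. 198–199; §13.8 pp. 212–218) (ED. 4 import)
import HarnessLib

/-!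
# R90-TF — INDEX (ED. 4) · architect `R90-arch1` (g2) · 2026-09-04T22:20Z (ED. 3 f0c75d3704cbd9a3 49c2b069b4c4; ED. 2 c09d6c7dd772a5b8 76df39457ee2)

The ONE Lines index of the R90-TF slab (HUMAN RULING «R90-TF SLAB — MAX PUSH», director BRIEF v2 1f40d54518340a35 §2;
R90-TF LEAD rulings #1–#19; programme laws C1–C5 + L8∕L9).  Companion prose map (every Rogawski1990 Prop shell on the path,
tagged ★ ∕ SOCK ∕ OPEN): `run/shared/lean/pub/hodgecm-mathlib/R90/R90-arch1/g2/SECTION-MAP.md` (ED. 2, delivered with this edition); DAG alone: `R90/ARCH-DAG.v2.md`.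

This file RESTATES NOTHING.  It imports the four S-layer leaf files and EVERY R90 section file in the tree (24 imports; the
import list IS the junction census: ALL thirty-six R90 section files in tree co-elaborate in one environment; ED. 3 added S2 B, S3 B, S4 A, S8 B; ED. 4 adds S2 A′, S2 C, S3 D, S3 E, S3 F (two-place `h3` edition), S4 C, S5 C, S5 C2, S5 E (floor E2), S6 C, S6 D (floor E1), S7 B, S7 C, S10 B, S10 D, S10 E; Q-S1 of record (ledger l.73056∕l.73058, LEAD #30): archimedean cuspidality — the S8-A road (ii)–(vii), S6 weighted∕M-terms and S10 weighted-hyperbolic sockets are VANISHED by their pens' own editions, nothing in this index depends on them), and states the S-layer ROOTS as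
sorry-free theorems from the sections' TOP sockets BY NAME (junction rule: a consumer imports the producer's top socket
byte-identically; a junction certified here = the composition elaborates).  `sorry` count of THIS file = 0; every `sorryAx` it
carries enters through a NAMED `stub_*` ∕ `sock_*` of an imported socket file, listed per theorem.
NEVER `ledger skeleton check` on this file (by-write on stmt-HodgeConjecture-24833 only).

## ROOTS (leaves of h413 paid by R90-TF) — ED. 4 status (theorems unchanged from ED. 2; only imports + this census moved)
* R1 S2♯  `F0U3LettersRung1.stub_S2sharp : Rogawski1990.cohDiscrete_memXiFamily_archPinned` (AGG :97) — **THREADED** `s2sharp_R90` below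
          ⟸ {S5 `stub_R90_1336c_membership`, S2 `stub_R90_S2_archPacketIota`, S2 `stub_R90_S2_archPacketCompact`} (CENTRAL-ι ★; FIN via S5 B, Ξ∞ via S2 ΞA).
* R2 FIN  `F0P3cS2SharpPaydown.stub_S2fin : S2FinLetter` (:348) — **THREADED** `s2Fin_of_S5 := R90.S5.stub_S2fin_of_spine` ⟸ {S5 `stub_R90_1336c_membership`}.
* R3 Ξ∞   `F0P3cS2SharpPaydown.stub_S2qpsi : S2QpsiLetter` (:363) — **THREADED** `s2Qpsi_of_S2 := R90.S2.s2Qpsi_paid` ⟸ {S2 Σ∞-ι, Σ∞-cpt}.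
* R4 PK   `F0U3LettersRung1.stub_PKtupleK2 : PKtupleLetterK2` (AGG :326) — hypothesis form `pk_of_printOrgans` (O1″ ∧ O2; O3∕O4∕O5∕O8a∕O8b ★ by name).
          O1″ ⟸ S7 (A ED. 3 in tree: S7#6 `stub_R90_S7_formSignOffRam` ★-TIED by ★ p861477; «G-SIDE CUT» waits on E-S4 = S4 A `R90_S4_LocalKitExportA` (TOP
          `stub_R90_S4_localClassification`, IN TREE b5fbaaeb3ca45137, imported here) + E-S2 G-side `R90_S2_ArchKitExportA` (LEAD #10 (B) (a′) label carriers); ED. 3 «H∞ CUT» waits on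
          E-S5 = S5 C `R90_S5_HSideExportC` (GREEN at home) — EXPORT-EDGES-S7 v2 c0dff250d6fee2d5); O2 ⟸ S5 + S1 + S6 + S3 (no composition in tree yet).
* R5 O2♮  `F0P3cDbTPaydown.stub_xiPacketRigidCoreSc : StubXiPacketRigidCoreSc` (:423) — **THREADED TWICE**: `o2natural_R90_S9A` ⟸ {S9 A `stub_globalXiMembership`}
          (ED. 1 road; since S9 A ED. 3 «B-PAY» that stub is itself sorry-free and both roads meet in S9 B's sockets) and `o2natural_R90` ⟸ {S5 D `stub_R90_1335_qsXiRigidity`, S9 B `sock_S9_similitudeTransport`, S9 B `sock_S9_definiteXiMembership`}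
          (ED. 2 road through S9 B's HEAD `xiMembershipAt_of_cases`, B2 ★ `indefiniteSimilitude_holds`, and JUNCTION J3ᴮ `qsXiMembership_of_S5D` = S9.B1 ≡ S5#4; S9 B ED. 2 pays B1 from S5#4 in the file itself).
* R6 (S-β) (consumer `stub_StCharTS`, leaf L4 — not an R90 closable) — hypothesis form `sBeta_of_S10` ⟸ `E1St1383Letter`; S10 files A `R90_S10_SimpleTF1383A` ∕
          B `R90_S10_TwistedComparisonDatumB` (typ1∕typ2 g2 re-armed 15:40Z) pay it BY NAME; S10 C (zero-slice defs, PROVED `pinnedEq1383_of_stabilisedAtEvp`) in tree.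

## DAG (ED. 2; sections S1…S10 as RULED — LEAD #6: S1 = local non-arch §12.1–12.2; S6 ⊇ Rogawski Ch. 10; LEAD #9: Sθ-fields∕T1e∕T1f OWNED by S8, flow S5 → S8 → S6)
```
 S1 §12.1–2 local p-adic (A non-split: 4 sockets · B split: 1 socket) ──► S4 [B ED. 2 `IsRogPacketH` #B1 ★-tied + 5 sockets · A E-S4 `rogawskiLocalKit` TOP `stub_R90_S4_localClassification` (in tree)]
 S1, S3-C [def fibre objects] ──► S3-A 13.1.1 `stub_R90_S3_endoExpansion_exists` (imports S4-B) ──► S3-B ★ `kt2Clause_of_endoExpansion` (14.6.3∕KT2) ──► S4-A, S7 (G-side cut), S9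
 S2 ΞA (Σ∞-ι, Σ∞-cpt ⟹ Ξ∞ PAID) ──► R3 ;  S2 B (§12.3 datum, in tree) ∕ A′ (E-S2 arch kit, KT1 — typing) ──► S7, S10-E
 S5 A spine `stub_R90_1336c_membership` ──► S5 B `s2Fin_of_spine` ──► R2 ;  R2 + R3 ──[★ `stub_S2sharp_of_organs`]──► R1 S2♯  (THREADED `s2sharp_R90`)
 S10 (J-S5→S10 comparison datum; payer of record S10 D ED. 2, LEAD #16 (A3)) ──► S5 D (S-G)@Φ₃ `stub_R90_1335_qsXiRigidity` ══(J3ᴮ, defeq)══► S9 B1 ;  S9 B {B1, B2 ★, B3, B4} ──[HEAD `xiMembershipAt_of_cases`]──► S9 A (S-G) ──[J1∘HEAD]──► R5 O2♮ (THREADED `o2natural_R90`)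
 S8 A (`Pinning`, `eq1361G_of_pinning`, (e2) `nHalf_of_specs`) ──► S6, S10-D ;  S8 B `R90_S8_ResidualSpectrumU3B` (§13.9, 6 sockets, in tree) ──► S6 T1e∕T1f ;  S8 defines `ov_cm`∕Sθ-fields + owns T1e∕T1f (LEAD #9)
 S6 A (T1c∕T1d texts, 14.5.1 (b) composition ★) + S6 B TOP `sock_S6_langlandsDichotomy` ──[engine `mTermCancellationSm_of_dichotomy`]──► T1d ──► S7 (14.6), S9 B4, S10
 S10 C zero-slice defs ──► S10 E (FLOOR `stub_R90_ext_pseudoCoeffDS_u`) ──► S10 C2∕B ──► S10 A (13.8.3 at v; A2d = (β) LEAD #16 (A1); TOP `E1St1383Letter` BY NAME), S8-A ──► S10 D ──[★ `stSpectralHyp_of_line`]──► R6 (S-β)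
 S4-A [def E-S4] + S2 [def E-S2] + S5-C [def E-S5] ──► S7 ED. 2∕3 `pkTupleBaseK2μ_of_sigmas` ──► O1″ ;  S5 + S1 + S6 + S3 ──► O2 ;  O1″ + O2 ──[★ `PKtupleK2_of_organs`]──► R4 PK
 FLOOR OF RECORD (LEAD #18 (1); NR-4 human word pending): (E1) FL∕p-adic transfer → S6 `sock_S6_ext_*` (named facts) · (E3) HC local harmonic analysis · (E4) Borel–Wallach ★ · (E5) Shelstad archimedean transfer = `sock_S6_ext_archTransferShelstad` OWNED BY S6 A (one home; S10-E∕S3∕S7 consume it hypothesis-first BY NAME) · (E2) GL₃ base change = ★ NAMED FACT `Mok2014_weakBaseChange` (LEAD #16 (C), no `stub_R90_ext_baseChangeGL3`); also S8-A `sock_S8_ext_kysCentreU2`, S10-E `stub_R90_ext_pseudoCoeffDS_u`.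
```
## JUNCTIONS OF RECORD (producer TOP socket ↦ consumer) — ED. 3 (J3ᴬ∕J3ᴮ nomenclature of R90-IF-plan adopted; LEAD #16 folded)
* S5.1336c := `R90.S5.stub_R90_1336c_membership : XiMembershipOfArchJLetter` → S5 B `s2Fin_of_spine` (R2) and `s2sharp_of_spine_qpsi`; C2′ ★ `xiMembershipOfArchJ_of_S2flat`.
* S2.Ξ∞ := `R90.S2.s2Qpsi_paid : F0P3cS2SharpPaydown.S2QpsiLetter` (the LEAF letter by name; Σ∞-cpt name = leaf PIN-τ, ★ `R90.S2.pinCompactLetter_iff`).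
* S9.TOP := `R90.S9.TopXiPacketRigidCoreSc` ≡ leaf `F0P3cDbTPaydown.StubXiPacketRigidCoreSc` (`o2natural_of_S9_top := h`); (S-G) ⟺ (S-U) (★ J1∕J1⁻¹ in S9 A).
* J3ᴮ := `R90.S9.SocketQsXiMembership` (B1) ⟸ `R90.S5.SocketQsXiRigidity` (S5#4) — CERTIFIED below (`qsXiMembership_of_S5D`) and PAID in S9 B ED. 2; ONE LEAF, HOMED IN S5.  J3ᴬ := S9 A `scUnique_of_xiPacketRigidCoreSc` (O2♮ ⇒ (S-U), over ★ p861411).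
* J-S5→S10 (LEAD #16): (A1) S10 A2d `sock_S10_levelCutG` = (β) countable level-wise-finite cut onto ★ `E1St1383Letter` — NO edge S5 → S10, no 2-cycle; (A2) the J-S5→S10 comparison-datum socket is honest only if its PINS bite the functionals: binders fix the carriers of record (LEAD #13 (2)) AND «𝔨 agrees with `R90.S8.ov_cm` on `toAdelic φ`» (S5-audit1 junk-𝔨 probe decides PASS∕COSTUME; COSTUME ⇒ S5 D adds pins (a)(b), no new ∃); (A3) PAYER OF RECORD for the honest 𝔨 = S10 FILE D ED. 2 (on S8's pinned 𝔖 + E-S4); no prover on A2d-(α) or on a consumer of an S10 head before (A2) settles. LEAD #18 (2) (S5 J1 ruling of record, S5-audit1 kernel certificate bdd77acf197a3ad2 «all 15 Laws junk-satisfiable»): NO «∃ 𝔨, Laws ∧ pins» socket anywhere in R90 — any posited-kit ∃ is costume (C5∕L8); kits enter as DEFINED data with laws proved, or hypothesis-first by name.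
* S9.B → S9.A := `SocketGlobalXiMembership` ⟸ B's four sockets via `xiMembershipAt_of_cases` — CERTIFIED below (`globalXiMembership_of_S9B_cases`; = the A ED. 2 «B-PAY» line).
* S3∕S4 fibre home := S3 C (`endoCoeff`, `endoFibre`, `IsStableFinsetH`) imported by S3 A, S3 B, S4 A (LEAD #10 (A), #14 (2): `pair := endoCoeff`, `xiH`-image `= endoFibre` by `rfl`).
* S4 H-carrier := `PktH := PktIdx (HLoc L v) (IsRogPacketH ∧ ¬ IsExceptionalH)` (LEAD #14 (1) «= T1»); `stub_R90_S5_discH_nonexceptional` OWNED by S5 C.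
* S5.1331-multOne := E1 GlobalIndex :398 `sig_K2E1MultiplicityOneU3` (LEAD #5 (2): INDEX-ONLY; R90 files do not import the sorried GlobalIndex).
* S8 (e2) := ★ `SpectralPacketG.piXiHm_n_existsDisc_eq_half_of_xiRigidityH` (nothing owed; S8 A `nHalf_of_specs` is the carpet adapter); TG OF RECORD (LEAD #13 (2)) =
  ★ `K2E1GlobalTestFunctions.GlobalTestFunction L 3 (qsForm L)` ∕ `GlobalTestFunctionGt` ∕ H-side `PureTensor₂`, traces at ★ `toAdelic φ`.
* S10.TOP := `E1St1383Letter` BY NAME (S10 A `sock_S10_*` cut of ★ `Pinned1383Letter` + ★ `e1St1383Letter_of_pinned1383`; zero datum pays B-side sockets — AUDIT S10 (J1-i)).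
* S6∕S8 Sθ-currency := `SpecOverride`∕`ComparisonKit.override` (`F0_U3LettersRung1Defs` :151∕:185); S6 B inlines S6 A's T1c∕T1d bodies byte-for-byte (S6 FILE C reconciles, DEAL ED. 2a).
* DORMANT edge (LEAD #9 J-E1): «E1.5Res@G12 ⇐? S8#3» — not a dependency, not staffed.
* TREE CENSUS at this edition (mechanical: `sorry` TOKENS in code after stripping comments, per file, 16:29Z): 26 R90 section files + this index; code-sorry 26 = S1 A 1 · B 0 · S2 A′ 2 · ΞA 2 · B 1 · S3 A 1 · B 0 · C 0 · D 5 · S4 A 1 · B 2 · S5 A 1 · B 0 · C 1 · D 2 · S6 A∕B∕C 0 · S7 A∕B 0 · S8 A 1 (FLOOR-class? no: [KyS] in-estate per LEAD #20∕#24) · B 4 · S9 A 0 · B 2 · S10 C∕D 0 (earlier editions counted socket DECLS incl. docstring mentions — not comparable). FLOOR (NR-4 interim, director s1991; LEAD #20 owners E1 S6 · E2 S5 · E3 S1 · E4 S2; #23 (E1) sub-cells; #24 (E1) bottom file `R90_S6_FloorE1D`, (E2) NF [MW89] + abbrevs): SIZED 4∕4 — roll-up `R90/R90-arch1/g2/FLOOR-SIZING-ROLLUP.md`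 af979696be96e654 (statement layer to type ≈ 2.0–3.9 kLoC, all 48-h-typable; proof layer below the floor E1 125–245 kLoC · E2 35–70 · E3 1.0–1.9 MLoC · E4 10–20, not booked).

HONEST LABEL: HC_CM is proved only modulo the 7 printed citations (2 remaining named inputs: hLiu418 = stmt-HodgeConjecture-24832,
h413 = stmt-HodgeConjecture-24833) — DISTANCE TO ZERO: citations 3 ∕ leaves 7 (closable 3 · S-layer 4+) ∕ axioms 0 — until rung 0 closes.
REL ≠ ★ ≠ BUILT; nothing in this file closes anything; it certifies junctions (the THREADED roots carry `sorryAx` through the named section sockets).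
-/

set_option linter.dupNamespace false

namespace Summit.HodgeConjecture.HodgeConjecture.R90.TFIndex

open Summit.HodgeConjecture.HodgeConjecture.Cruxes.H413

/-! ## R1 · S2♯ from FIN and Ξ∞ (hypothesis form; CENTRAL-ι is ★ `s2CentralIota_holds`) -/

/-- CASIMIR-ι from Ξ∞ supplied as a HYPOTHESIS (the leaf's `casimirIota_holds` with `stub_S2qpsi` replaced by `hQ`; ★ (B6) `sq_sum_eq_two_iff_qψ_of_split`). -/
theorem casimirIota_of_qpsi (hQ : F0P3cS2SharpPaydown.S2QpsiLetter) : F0P3cS2SharpPaydown.S2CasimirIotaLetter := by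
  intro L _ _ _ ι H T hT hdef h2 μ _ μω hμu hμω P hP M _ _ σK σ𝔤 hM hirr htok ξ hmem a b c habc
  exact (F0P3cXiCentralAllPlaces.sq_sum_eq_two_iff_qψ_of_split F0P3cXiCentralCharSplit.xiCentralCharSplit
    L ι H T hT hdef h2 μ μω hμu hμω P hP ξ hmem ι a b c habc).mpr (hQ L ι H T hT hdef h2 μ μω hμu hμω P hP ξ hmem ι)

/-- CASIMIR-τ from Ξ∞ supplied as a HYPOTHESIS (the leaf's `casimirTau_holds` with `stub_S2qpsi` replaced by `hQ`). -/
theorem casimirTau_of_qpsi (hQ : F0P3cS2SharpPaydown.S2QpsiLetter) : F0P3cS2SharpPaydown.S2CasimirTauLetter := by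
  intro L _ _ _ ι H T hT hdef h2 μ _ μω hμu hμω P hP hKc ξ hmem τ hτ a b c habc
  exact (F0P3cXiCentralAllPlaces.sq_sum_eq_two_iff_qψ_of_split F0P3cXiCentralCharSplit.xiCentralCharSplit
    L ι H T hT hdef h2 μ μω hμu hμω P hP ξ hmem τ a b c habc).mpr (hQ L ι H T hT hdef h2 μ μω hμu hμω P hP ξ hmem τ)

/-- PIN-τ from Ξ∞ supplied as a HYPOTHESIS (★ (K1) `F0P3cPinCompactChi.pinCompact_of_casimirTau`). -/
theorem pinCompact_of_qpsi (hQ : F0P3cS2SharpPaydown.S2QpsiLetter) : F0P3cS2SharpPaydown.S2PinCompactLetter :=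
  F0P3cPinCompactChi.pinCompact_of_casimirTau (casimirTau_of_qpsi hQ)

/-- **R1 · S2♯ ⟸ FIN ∧ Ξ∞** — the closer's `stub_S2sharp` TYPE from the two open organs as hypotheses (★ head `stub_S2sharp_of_organs`, ★ CENTRAL-ι).
Converse read-backs ★ `s2Fin_of_S2sharp`, `qpsi_of_S2sharp'` (so S2♯ ⟺ FIN ∧ Ξ∞ over ★). -/
theorem s2sharp_of_fin_qpsi (hFin : F0P3cS2SharpPaydown.S2FinLetter) (hQ : F0P3cS2SharpPaydown.S2QpsiLetter) :
    Literature.NumberTheory.Rogawski1990.cohDiscrete_memXiFamily_archPinned :=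
  F0P3cS2SharpPaydown.stub_S2sharp_of_organs hFin F0P3cS2SharpPaydown.s2CentralIota_holds (casimirIota_of_qpsi hQ) (pinCompact_of_qpsi hQ)

/-! ## ED. 2 · R2 ∕ R3 ∕ R1 THREADED from the section files (sorry-free here; `sorryAx` via the named section sockets only) -/

/-- **R3 · Ξ∞ THREADED from S2 ΞA** — the leaf letter `S2QpsiLetter` is S2's PAID line by name (⟸ {`stub_R90_S2_archPacketIota`, `stub_R90_S2_archPacketCompact`}).
[cite: Rogawski1990, §14.6 Thm. 14.6.4 pp. 243–244; §15.2 Prop. 15.2.1] -/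
theorem s2Qpsi_of_S2 : F0P3cS2SharpPaydown.S2QpsiLetter := R90.S2.s2Qpsi_paid

/-- **R3 · Ξ∞ from S2's two sockets as HYPOTHESES** (TRIO; S2's `s2Qpsi_of_sigmas` by name — Σ∞-cpt is the leaf PIN-τ letter byte for byte). -/
theorem s2Qpsi_of_S2_sigmas (hι : R90.S2.ArchPacketIotaLetter) (hc : F0P3cPinCompactChi.S2PinCompactLetter) :
    F0P3cS2SharpPaydown.S2QpsiLetter :=
  R90.S2.s2Qpsi_of_sigmas hι hc

/-- **R2 · FIN THREADED from S5 B** — `stub_S2fin_of_spine` by name (⟸ {`stub_R90_1336c_membership`}). [cite: Rogawski1990, §13.3 Thm. 13.3.6 (c) p. 202; §14.6 Thm. 14.6.4] -/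
theorem s2Fin_of_S5 : F0P3cS2SharpPaydown.S2FinLetter := R90.S5.stub_S2fin_of_spine

/-- **R2 · FIN from the S5 spine socket as a HYPOTHESIS** (TRIO; S5 B `s2Fin_of_spine` by name). -/
theorem s2Fin_of_S5_spine (hG : R90.S5.XiMembershipOfArchJLetter) : F0P3cS2SharpPaydown.S2FinLetter := R90.S5.s2Fin_of_spine hG

/-- **R1 · S2♯ from the THREE section sockets as HYPOTHESES** (TRIO): (G∞) spine ∧ Σ∞-ι ∧ Σ∞-cpt ⟹ `cohDiscrete_memXiFamily_archPinned`
— the closer's `stub_S2sharp` TYPE.  This is the R90-TF road for leaf LH1 in full. [cite: Rogawski1990, §13.3 Thm. 13.3.6 (c); §14.6 Thm. 14.6.4; §15.2 Prop. 15.2.1 (b)] -/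
theorem s2sharp_of_sections (hG : R90.S5.XiMembershipOfArchJLetter) (hι : R90.S2.ArchPacketIotaLetter)
    (hc : F0P3cPinCompactChi.S2PinCompactLetter) : Literature.NumberTheory.Rogawski1990.cohDiscrete_memXiFamily_archPinned :=
  s2sharp_of_fin_qpsi (R90.S5.s2Fin_of_spine hG) (R90.S2.s2Qpsi_of_sigmas hι hc)

/-- **R1 · S2♯ THREADED** — `sorryAx` enters through EXACTLY {S5 `stub_R90_1336c_membership`, S2 `stub_R90_S2_archPacketIota`, S2 `stub_R90_S2_archPacketCompact`}. -/
theorem s2sharp_R90 : Literature.NumberTheory.Rogawski1990.cohDiscrete_memXiFamily_archPinned :=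
  s2sharp_of_fin_qpsi R90.S5.stub_S2fin_of_spine R90.S2.s2Qpsi_paid

/-! ## R4 · PK from the two PRINT organs O1″, O2 (O3∕O4∕O5∕O8a∕O8b are ★ and enter by name) -/

/-- **R4 · PK ⟸ O1″ ∧ O2** — the closer's `stub_PKtupleK2` TYPE from the two open print organs as hypotheses (★ head `PKtupleK2_of_organs`).
Sections: O1″ ⟸ S7 (ED. 2 «G-SIDE CUT» after E-S4∕E-S2, ED. 3 «H∞ CUT» after E-S5; kit-free layer `R90.S7.stub_R90_S7_formSignOffRam` in tree);
O2 ⟸ S5 `stub_R90_1336c_membership` + S1 (a.e.-πⁿ) + S6 (kit transport) + S3 (πˢ signed). -/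
theorem pk_of_printOrgans (hBase : F0U3LettersRung1.PKtupleBaseLetterK2μ) (hRC : F0U3LettersRung1.PKrigidCoreLetter) :
    F0U3LettersRung1.PKtupleLetterK2 :=
  F0U3LettersRung1.PKtupleK2_of_organs hBase hRC F0U3LettersRung1.stub_PKrigidGOfCore F0U3LettersRung1.stub_PKrigidHOfKR
    F0U3LettersRung1.stub_PKvalueGOfRigidH F0U3LettersRung1.stub_PKsaU2 F0U3LettersRung1.stub_PKmultOneU2

/-! ## R5 · O2♮ THREADED from S9 (file A ED. 1 road; file B cases road via JUNCTION S9-J3 to S5 D) -/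

/-- **JUNCTION CERTIFICATE S9.TOP ≡ leaf O2♮**: S9's top socket `TopXiPacketRigidCoreSc` and the leaf letter `StubXiPacketRigidCoreSc` are the same
proposition (the `id` proof elaborates iff the two closed `Prop`s are definitionally equal — the byte guard of the junction rule). -/
theorem o2natural_of_S9_top (h : R90.S9.TopXiPacketRigidCoreSc) : F0P3cDbTPaydown.StubXiPacketRigidCoreSc := h

/-- **R5 · O2♮ ⟸ S9 (S-G)** (S9 A ★ `xiPacketRigidCoreSc_of_globalXiMembership` = J1 ∘ HEAD). -/
theorem o2natural_of_S9_globalXiMembership (hG : R90.S9.SocketGlobalXiMembership) : F0P3cDbTPaydown.StubXiPacketRigidCoreSc :=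
  o2natural_of_S9_top (R90.S9.xiPacketRigidCoreSc_of_globalXiMembership hG)

/-- **R5′ · O2♮ ⟸ S9 (S-U)** (the uniqueness form; S9 A ★ `xiPacketRigidCoreSc_of_scUnique`). -/
theorem o2natural_of_S9_scUnique (hU : R90.S9.SocketScUnique) : F0P3cDbTPaydown.StubXiPacketRigidCoreSc :=
  o2natural_of_S9_top (R90.S9.xiPacketRigidCoreSc_of_scUnique hU)

/-- **R5 · O2♮ THREADED (ED. 1 road)** — S9 A's PAID top by name; `sorryAx` via EXACTLY {S9 A `stub_globalXiMembership`}. -/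
theorem o2natural_R90_S9A : F0P3cDbTPaydown.StubXiPacketRigidCoreSc := o2natural_of_S9_top R90.S9.xiPacketRigidCoreSc_paid

/-- **JUNCTION S9-J3 (R90-IF-plan 2026-09-04T15:23:38Z): S9.B1 `SocketQsXiMembership` ⟸ S5#4 `SocketQsXiRigidity`** — same (S-G)@Φ₃ body, the two Hermitian∕unit
proof arguments are proof-irrelevant; ONE LEAF, HOMED IN S5 D (`stub_R90_1335_qsXiRigidity`, first GREEN BW148). [cite: Rogawski1990, §13.3 Thm. 13.3.6 (c) p. 202] -/
theorem qsXiMembership_of_S5D (h : R90.S5.SocketQsXiRigidity) : R90.S9.SocketQsXiMembership :=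
  fun L _ _ _ => h L

/-- **JUNCTION S9.B → S9.A (the A ED. 2 «B-PAY» line, certified here ahead of the edition): (S-G) from B's four sockets as HYPOTHESES** via B's HEAD
`xiMembershipAt_of_cases` (TRIO).  `SocketGlobalXiMembership` (A) is `∀ L H hH hHd, XiMembershipAt L H hH hHd` (B) on the nose (S9-typ1 CERT-B0 3edf0ec5e434797a). -/
theorem globalXiMembership_of_S9B_cases (hqs : R90.S9.SocketQsXiMembership) (hI : R90.S9.SocketIndefiniteSimilitude)
    (hT : R90.S9.SocketSimilitudeTransport) (hD : R90.S9.SocketDefiniteXiMembership) : R90.S9.SocketGlobalXiMembership :=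
  fun L _ _ _ H hH hHd => R90.S9.xiMembershipAt_of_cases hqs hI hT hD L H hH hHd

/-- (S-G) from B's PAID head by name (`sorryAx` via B's three sorried sockets B1∕B3∕B4; B2 ★). -/
theorem globalXiMembership_of_S9B : R90.S9.SocketGlobalXiMembership :=
  fun L _ _ _ H hH hHd => R90.S9.xiMembershipAt_paidB L H hH hHd

/-- **R5 · O2♮ from the THREE open section sockets as HYPOTHESES** (TRIO): S5#4 (S-G)@Φ₃ ∧ S9 B3 similitude transport ∧ S9 B4 §14.6 definite leaf ⟹ leaf O2♮
(B2 indefinite similitude is ★ `R90.S9.indefiniteSimilitude_holds`; B1 is S5#4 by J3).  This is the R90-TF road for leaf LH10 in full.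
[cite: Rogawski1990, §13.3 Thm. 13.3.6 (c) p. 202; §14.6 Thm. 14.6.1 p. 241, Thm. 14.6.4 pp. 243–244; §1.9 p. 8] -/
theorem o2natural_of_sections (hR : R90.S5.SocketQsXiRigidity) (hT : R90.S9.SocketSimilitudeTransport)
    (hD : R90.S9.SocketDefiniteXiMembership) : F0P3cDbTPaydown.StubXiPacketRigidCoreSc :=
  o2natural_of_S9_globalXiMembership
    (globalXiMembership_of_S9B_cases (qsXiMembership_of_S5D hR) R90.S9.indefiniteSimilitude_holds hT hD)

/-- **R5 · O2♮ THREADED (ED. 2 road)** — `sorryAx` enters through EXACTLY {S5 D `stub_R90_1335_qsXiRigidity`, S9 B `sock_S9_similitudeTransport`, S9 B `sock_S9_definiteXiMembership`}. -/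
theorem o2natural_R90 : F0P3cDbTPaydown.StubXiPacketRigidCoreSc :=
  o2natural_of_sections R90.S5.stub_R90_1335_qsXiRigidity R90.S9.sock_S9_similitudeTransport R90.S9.sock_S9_definiteXiMembership

/-! ## C2′ certificate for the S5 spine socket (by name): S2♭ ⟹ (G∞) -/

/-- **C2′ certificate** (S5 A ★ `xiMembershipOfArchJ_of_S2flat`): the spine socket is not stronger than the record shell S2♭. -/
theorem spine1336c_of_S2flat (hS : Literature.NumberTheory.Rogawski1990.cohDiscrete_memXiFamily) : R90.S5.XiMembershipOfArchJLetter :=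
  R90.S5.xiMembershipOfArchJ_of_S2flat hS

/-! ## R6 · (S-β) from S10's input socket of record (E1 tier-0), by name -/

/-- **R6 · (S-β) ⟸ S10** — `StSpectralHypLetter` (the TYPE of leaf L4's organ `stub_StSpectralHyp`) from `E1St1383Letter` as a hypothesis (★ `stSpectralHyp_of_line`). -/
theorem sBeta_of_S10 (hE1 : K2E1TraceFormulaBeta.E1St1383Letter) : K2E1TraceFormulaBeta.StSpectralHypLetter :=
  K2E1TraceFormulaBeta.stSpectralHyp_of_line hE1

end Summit.HodgeConjecture.HodgeConjecture.R90.TFIndex
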